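import Literature.MathematicalPhysics.QuantumFieldTheory.OverlapQCDOS
import Literature.MathematicalPhysics.QuantumLattice.OverlapDirac
import HarnessLib

/-!
# `qcdOverlapDirac` is `overlapDirac` at `SU(3)`, `m₀ = 1`: the positivity API of the overlap
operator specialised to the functionals of admissible-overlap lattice QCD

Trunk `Literature/MathematicalPhysics/QuantumFieldTheory`. Theorem-only companion of
`OverlapQCDOS.lean` (the twins of the `QCDOS` functionals for route
`QuantumFields/QCD/OverlapPositivityTransfer`) and of
`Literature/MathematicalPhysics/QuantumLattice/OverlapDirac.lean` (Neuberger's massive overlap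
operator `overlapDirac ρ U m₀ μ` for a general colour representation and projection point, with its
proved API). The fixed-parameter `qcdOverlapDirac U μ` of `OverlapQCDOS` (fundamental `SU(3)`,
`m₀ = r = 1`) is DEFINITIONALLY `overlapDirac (fundamentalRep (Fin 3)) U 1 μ`
(`qcdOverlapDirac_eq_overlapDirac`, `rfl`), so every statement of `OverlapDirac.lean` transports:
`Γ₅`-hermiticity and reality of `det D_μ` for every `μ`; off the exceptional set
`det(Γ₅ D_W(U,-1,1)) = 0`: `Re det D_μ > 0` for `μ > 0` (the content of the route's support item
`OverlapDeterminantPositivity`), hence the flavour product `∏_f det D_{μ_f}(U)` is a positive real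
for positive bare masses (the integrand of `overlapPartitionFn_eq`).

## References

[Neuberger1998] [GiustiEtAl2002] [Luscher1998]
-/

noncomputable section

open Matrix Complex
open Literature.MathematicalPhysics.QuantumLattice Literature.Probability.LatticeModels

namespace Literature.MathematicalPhysics.QuantumFieldTheory

section OneTorus

variable {S : ℕ} [NeZero S]

/-- `qcdOverlapDirac U μ = overlapDirac (fundamentalRep (Fin 3)) U 1 μ` (definitional).
[cite: GiustiEtAl2002, §2 eqs. (2.3)–(2.4)] -/
theorem qcdOverlapDirac_eq_overlapDirac (U : GaugeConfig 4 S (Matrix.specialUnitaryGroup (Fin 3) ℂ))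
    (μ : ℝ) :
    qcdOverlapDirac U μ = overlapDirac (fundamentalRep (Fin 3)) U 1 μ :=
  rfl

/-- The route's exceptional-set hypothesis `det(Γ₅ D_W(U,-1,1)) ≠ 0` is `det H(1) ≠ 0` for the
overlap kernel `overlapKernel (fundamentalRep (Fin 3)) U 1` (definitional).
[cite: Neuberger1998, eq. (8)] -/
theorem overlapKernel_fundamentalRep_one
    (U : GaugeConfig 4 S (Matrix.specialUnitaryGroup (Fin 3) ℂ)) :
    overlapKernel (fundamentalRep (Fin 3)) U 1 =
      spinorLift gammaFive * wilsonDirac (fundamentalRep (Fin 3)) U (-1) 1 :=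
  rfl

/-- **`Γ₅`-hermiticity** of the QCD overlap operator: `Γ₅ D_μ Γ₅ = D_μ†`.
[cite: GiustiEtAl2002, §2 eq. (2.1)] -/
theorem qcdOverlapDirac_gammaFive_hermitian
    (U : GaugeConfig 4 S (Matrix.specialUnitaryGroup (Fin 3) ℂ)) (μ : ℝ) :
    spinorLift gammaFive * qcdOverlapDirac U μ * spinorLift gammaFive = (qcdOverlapDirac U μ)ᴴ :=
  overlapDirac_gammaFive_hermitian (fundamentalRep (Fin 3)) U 1 μ

/-- **The QCD overlap determinant is real** for every real bare mass.
[cite: Neuberger1998, eq. (10)] -/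
theorem qcdOverlapDirac_det_im (U : GaugeConfig 4 S (Matrix.specialUnitaryGroup (Fin 3) ℂ))
    (μ : ℝ) :
    ((qcdOverlapDirac U μ).det).im = 0 :=
  overlapDirac_det_im (fundamentalRep (Fin 3)) U 1 μ

/-- The QCD overlap determinant equals its real part (cast). [cite: Neuberger1998, eq. (10)] -/
theorem qcdOverlapDirac_det_eq_ofReal_re
    (U : GaugeConfig 4 S (Matrix.specialUnitaryGroup (Fin 3) ℂ)) (μ : ℝ) :
    (qcdOverlapDirac U μ).det = (((qcdOverlapDirac U μ).det).re : ℂ) :=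
  Complex.ext (by simp) (by simp [qcdOverlapDirac_det_im U μ])

/-- **Positivity of the massive QCD overlap determinant** off the exceptional set:
`Re det D_μ(U) > 0` for every `μ > 0` whenever `det(Γ₅ D_W(U,-1,1)) ≠ 0` — the route's support
item `OverlapDeterminantPositivity` up to unfolding. [cite: Neuberger1998, eq. (10)] -/
theorem qcdOverlapDirac_det_re_pos (U : GaugeConfig 4 S (Matrix.specialUnitaryGroup (Fin 3) ℂ))
    {μ : ℝ} (hμ : 0 < μ)
    (h0 : (spinorLift gammaFive * wilsonDirac (fundamentalRep (Fin 3)) U (-1) 1).det ≠ 0) :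
    0 < ((qcdOverlapDirac U μ).det).re :=
  overlapDirac_det_re_pos (fundamentalRep (Fin 3)) fundamentalRep_mem_unitaryGroup U 1 hμ h0

/-- **The flavour product `∏_f det D_{μ_f}(U)` is a strictly positive real** for positive bare
masses, off the exceptional set (the fermionic weight of `overlapPartitionFn_eq`).
[cite: Neuberger1998, eq. (10)] -/
theorem prod_det_qcdOverlapDirac_pos {Nf : ℕ}
    (U : GaugeConfig 4 S (Matrix.specialUnitaryGroup (Fin 3) ℂ)) {μ : Fin Nf → ℝ}
    (hμ : ∀ f, 0 < μ f)
    (h0 : (spinorLift gammaFive * wilsonDirac (fundamentalRep (Fin 3)) U (-1) 1).det ≠ 0) :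
    0 < (∏ f, (qcdOverlapDirac U (μ f)).det).re ∧ (∏ f, (qcdOverlapDirac U (μ f)).det).im = 0 := by
  have hprod : ∏ f, (qcdOverlapDirac U (μ f)).det =
      ((∏ f, ((qcdOverlapDirac U (μ f)).det).re : ℝ) : ℂ) := by
    rw [Complex.ofReal_prod]
    exact Finset.prod_congr rfl fun f _ => qcdOverlapDirac_det_eq_ofReal_re U (μ f)
  rw [hprod, Complex.ofReal_re, Complex.ofReal_im]
  exact ⟨Finset.prod_pos fun f _ => qcdOverlapDirac_det_re_pos U (hμ f) h0, rfl⟩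

end OneTorus

end Literature.MathematicalPhysics.QuantumFieldTheory

end
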